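import Summits.CriticalPhenomena.PercolationContinuityZ3.Theorems.PercNearOneGluingNoHeavyLowerTailKnQuestion8CoefficientwiseCoreClassKernelMixFull
import HarnessLib

/-!
# Clusters across a cut vertex (series composition of middle graphs)

Support file (`--supports stmt-CriticalPhenomena-4575`, closed), prover `prim-cplus-coupling` (gen 31).  No definitions, no notations, no named facts,
no sorries; standard axioms.  Memo `prim-cplus-coupling/A5-COUPLING-gen31.md` §2, §2b.  Used by `…CoreClassSeriesC6` / `…CoreClassSeriesMain`
(KB-SERIES: the core-class kernel for a series composition `H₁ ·_c H₂` of two middle graphs).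

Setting: a finite multigraph `ends : ι → Sym2 V` and two edge sets `E₁, E₂` whose edges share no vertex other than the CUT VERTEX `c`
(`hsep`); colourings `ω₁ ⊆ E₁`, `ω₂ ⊆ E₂`; `C_v(ω) = openCluster (ends '' ω) v`.
* `Coefficientwise.openCluster_side_stays` — a cluster of `ω₁ ⊆ E₁` rooted at a vertex off `E₂` meets the edges of `E₂` only at `c`.
* `Coefficientwise.openCluster_cut_root` — `C_c(ω₁ ∪ ω₂) = C_c(ω₁) ∪ C_c(ω₂)`.
* `Coefficientwise.openCluster_cut_side` — for a root `v` on no edge of `E₂`: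
  `C_v(ω₁ ∪ ω₂) = C_v(ω₁) ∪ {y | c ∈ C_v(ω₁) ∧ y ∈ C_c(ω₂)}` (the cluster crosses to the other side exactly when it reaches `c`).
* `Coefficientwise.sdiff_union_sdiff` — `(E₁ ∪ E₂) ∖ (ω₁ ∪ ω₂) = (E₁ ∖ ω₁) ∪ (E₂ ∖ ω₂)` for disjoint `E₁, E₂`.
All by the closed-set principle `openCluster_subset_of_closed`.
[cite: KozmaNitzan2024, Questions 8–9 (§5.5 p. 36) (context: the Question-8 pocket covariance programme)]
-/

namespace Summit.CriticalPhenomena.PercolationContinuityZ3.Theorems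

open Finset Literature.Probability.Percolation

namespace Coefficientwise

variable {ι V : Type*}

/-- A cluster of `ω₁ ⊆ E₁` rooted at a vertex `v` lying on no edge of `E₂` meets the edges of `E₂` only at the cut vertex `c`.
[cite: KozmaNitzan2024, §5.5 (context only; folklore)] -/
theorem openCluster_side_stays (ends : ι → Sym2 V) (E₁ E₂ ω₁ : Finset ι) (c v : V)
    (hsep : ∀ i ∈ E₁, ∀ j ∈ E₂, ∀ u, u ∈ ends i → u ∈ ends j → u = c) (hω₁ : ω₁ ⊆ E₁) (hv : ∀ j ∈ E₂, v ∉ ends j)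
    {y : V} (hy : y ∈ openCluster (ends '' (↑ω₁ : Set ι)) v) {j : ι} (hj : j ∈ E₂) (hyj : y ∈ ends j) : y = c := by
  by_cases hyv : y = v
  · subst hyv; exact absurd hyj (hv j hj)
  · obtain ⟨i, hi, hyi⟩ := exists_edge_of_mem_openCluster ends hy hyv
    exact hsep i (hω₁ hi) j hj y hyi hyj

/-- **Cut vertex, root `c`.**  `C_c(ω₁ ∪ ω₂) = C_c(ω₁) ∪ C_c(ω₂)` when the edges of `E₁ ⊇ ω₁` and `E₂ ⊇ ω₂` meet only at `c`.
[cite: KozmaNitzan2024, §5.5 (context only; folklore)] -/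
theorem openCluster_cut_root [DecidableEq ι] (ends : ι → Sym2 V) (E₁ E₂ ω₁ ω₂ : Finset ι) (c : V)
    (hsep : ∀ i ∈ E₁, ∀ j ∈ E₂, ∀ u, u ∈ ends i → u ∈ ends j → u = c) (hω₁ : ω₁ ⊆ E₁) (hω₂ : ω₂ ⊆ E₂) :
    openCluster (ends '' (↑(ω₁ ∪ ω₂) : Set ι)) c = openCluster (ends '' (↑ω₁ : Set ι)) c ∪ openCluster (ends '' (↑ω₂ : Set ι)) c := by
  apply Set.Subset.antisymm
  · refine openCluster_subset_of_closed ends (ω₁ ∪ ω₂) c (S := openCluster (ends '' (↑ω₁ : Set ι)) c ∪ openCluster (ends '' (↑ω₂ : Set ι)) c)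
      (Or.inl (mem_openCluster_self _ _)) ?_
    intro i hi p q he hp
    have hpi : p ∈ ends i := by rw [he]; exact Sym2.mem_mk_left p q
    rcases Finset.mem_union.mp hi with hi1 | hi2
    · rcases hp with hp | hp
      · exact Or.inl (mem_openCluster_of_edge ends hi1 he hp)
      · -- `p ∈ C_c(ω₂)` lies on the `E₁`-edge `i`: `p = c`
        have hpc : p = c := by
          by_cases hpc : p = c
          · exact hpc
          · obtain ⟨j, hj, hpj⟩ := exists_edge_of_mem_openCluster ends hp hpc
            exact hsep i (hω₁ hi1) j (hω₂ hj) p hpi hpj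
        rw [hpc] at he
        exact Or.inl (mem_openCluster_of_edge ends hi1 he (mem_openCluster_self _ _))
    · rcases hp with hp | hp
      · have hpc : p = c := by
          by_cases hpc : p = c
          · exact hpc
          · obtain ⟨j, hj, hpj⟩ := exists_edge_of_mem_openCluster ends hp hpc
            exact hsep j (hω₁ hj) i (hω₂ hi2) p hpj hpi
        rw [hpc] at he
        exact Or.inr (mem_openCluster_of_edge ends hi2 he (mem_openCluster_self _ _))
      · exact Or.inr (mem_openCluster_of_edge ends hi2 he hp)
  · intro y hy
    rcases hy with hy | hy
    · exact openCluster_image_mono ends Finset.subset_union_left c hy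
    · exact openCluster_image_mono ends Finset.subset_union_right c hy

/-- **Cut vertex, root on one side.**  For a root `v` lying on no edge of `E₂`:
`C_v(ω₁ ∪ ω₂) = C_v(ω₁) ∪ {y | c ∈ C_v(ω₁) ∧ y ∈ C_c(ω₂)}` — the cluster enters the other side exactly when it reaches the cut vertex.
[cite: KozmaNitzan2024, §5.5 (context only; folklore)] -/
theorem openCluster_cut_side [DecidableEq ι] (ends : ι → Sym2 V) (E₁ E₂ ω₁ ω₂ : Finset ι) (c v : V)
    (hsep : ∀ i ∈ E₁, ∀ j ∈ E₂, ∀ u, u ∈ ends i → u ∈ ends j → u = c) (hω₁ : ω₁ ⊆ E₁) (hω₂ : ω₂ ⊆ E₂)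
    (hv : ∀ j ∈ E₂, v ∉ ends j) :
    openCluster (ends '' (↑(ω₁ ∪ ω₂) : Set ι)) v =
      openCluster (ends '' (↑ω₁ : Set ι)) v ∪ {y | c ∈ openCluster (ends '' (↑ω₁ : Set ι)) v ∧ y ∈ openCluster (ends '' (↑ω₂ : Set ι)) c} := by
  apply Set.Subset.antisymm
  · refine openCluster_subset_of_closed ends (ω₁ ∪ ω₂) v
      (S := openCluster (ends '' (↑ω₁ : Set ι)) v ∪ {y | c ∈ openCluster (ends '' (↑ω₁ : Set ι)) v ∧ y ∈ openCluster (ends '' (↑ω₂ : Set ι)) c})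
      (Or.inl (mem_openCluster_self _ _)) ?_
    intro i hi p q he hp
    have hpi : p ∈ ends i := by rw [he]; exact Sym2.mem_mk_left p q
    rcases Finset.mem_union.mp hi with hi1 | hi2
    · rcases hp with hp | ⟨hc, hp⟩
      · exact Or.inl (mem_openCluster_of_edge ends hi1 he hp)
      · -- `p ∈ C_c(ω₂)` on an `E₁`-edge: `p = c ∈ C_v(ω₁)`
        have hpc : p = c := by
          by_cases hpc : p = c
          · exact hpc
          · obtain ⟨j, hj, hpj⟩ := exists_edge_of_mem_openCluster ends hp hpc
            exact hsep i (hω₁ hi1) j (hω₂ hj) p hpi hpj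
        rw [hpc] at he
        exact Or.inl (mem_openCluster_of_edge ends hi1 he hc)
    · rcases hp with hp | ⟨hc, hp⟩
      · -- `p ∈ C_v(ω₁)` on an `E₂`-edge: `p = c`, so the cluster has reached the cut vertex
        have hpc : p = c := openCluster_side_stays ends E₁ E₂ ω₁ c v hsep hω₁ hv hp (hω₂ hi2) hpi
        refine Or.inr ⟨by rw [← hpc]; exact hp, ?_⟩
        rw [hpc] at he
        exact mem_openCluster_of_edge ends hi2 he (mem_openCluster_self _ _)
      · exact Or.inr ⟨hc, mem_openCluster_of_edge ends hi2 he hp⟩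
  · intro y hy
    rcases hy with hy | ⟨hc, hy⟩
    · exact openCluster_image_mono ends Finset.subset_union_left v hy
    · have h1 : c ∈ openCluster (ends '' (↑(ω₁ ∪ ω₂) : Set ι)) v := openCluster_image_mono ends Finset.subset_union_left v hc
      have h2 : y ∈ openCluster (ends '' (↑(ω₁ ∪ ω₂) : Set ι)) c := openCluster_image_mono ends Finset.subset_union_right c hy
      exact SimpleGraph.Reachable.trans h1 h2

/-- Complements split along a disjoint union: `(E₁ ∪ E₂) ∖ (ω₁ ∪ ω₂) = (E₁ ∖ ω₁) ∪ (E₂ ∖ ω₂)` for `ω₁ ⊆ E₁`, `ω₂ ⊆ E₂`, `E₁ ∩ E₂ = ∅`.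
[cite: KozmaNitzan2024, §5.5 (context only; elementary)] -/
theorem sdiff_union_sdiff [DecidableEq ι] (E₁ E₂ ω₁ ω₂ : Finset ι) (hdisj : Disjoint E₁ E₂) (hω₁ : ω₁ ⊆ E₁) (hω₂ : ω₂ ⊆ E₂) :
    (E₁ ∪ E₂) \ (ω₁ ∪ ω₂) = (E₁ \ ω₁) ∪ (E₂ \ ω₂) := by
  ext i
  simp only [Finset.mem_sdiff, Finset.mem_union, not_or]
  constructor
  · rintro ⟨h1 | h2, hn1, hn2⟩
    · exact Or.inl ⟨h1, hn1⟩
    · exact Or.inr ⟨h2, hn2⟩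
  · rintro (⟨h1, hn1⟩ | ⟨h2, hn2⟩)
    · exact ⟨Or.inl h1, hn1, fun h => Finset.disjoint_left.mp hdisj h1 (hω₂ h)⟩
    · exact ⟨Or.inr h2, fun h => Finset.disjoint_left.mp hdisj (hω₁ h) h2, hn2⟩

/-- Membership of the far terminal: with `a` on no edge of `E₂`, `b` on no edge of `E₁`, `b ≠ a`:
`b ∈ C_a(ω₁ ∪ ω₂) ↔ c ∈ C_a(ω₁) ∧ b ∈ C_c(ω₂)`. [cite: KozmaNitzan2024, §5.5 (context only; folklore)] -/
theorem mem_openCluster_cut_far [DecidableEq ι] (ends : ι → Sym2 V) (E₁ E₂ ω₁ ω₂ : Finset ι) (c a b : V)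
    (hsep : ∀ i ∈ E₁, ∀ j ∈ E₂, ∀ u, u ∈ ends i → u ∈ ends j → u = c) (hω₁ : ω₁ ⊆ E₁) (hω₂ : ω₂ ⊆ E₂)
    (ha : ∀ j ∈ E₂, a ∉ ends j) (hb : ∀ i ∈ E₁, b ∉ ends i) (hba : b ≠ a) :
    b ∈ openCluster (ends '' (↑(ω₁ ∪ ω₂) : Set ι)) a ↔
      c ∈ openCluster (ends '' (↑ω₁ : Set ι)) a ∧ b ∈ openCluster (ends '' (↑ω₂ : Set ι)) c := by
  rw [openCluster_cut_side ends E₁ E₂ ω₁ ω₂ c a hsep hω₁ hω₂ ha]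
  constructor
  · rintro (h | h)
    · exfalso
      obtain ⟨i, hi, hbi⟩ := exists_edge_of_mem_openCluster ends h hba
      exact hb i (hω₁ hi) hbi
    · exact h
  · intro h; exact Or.inr h

/-- Membership of the cut vertex: with `a` on no edge of `E₂`: `c ∈ C_a(ω₁ ∪ ω₂) ↔ c ∈ C_a(ω₁)`.
[cite: KozmaNitzan2024, §5.5 (context only; folklore)] -/
theorem mem_openCluster_cut_vertex [DecidableEq ι] (ends : ι → Sym2 V) (E₁ E₂ ω₁ ω₂ : Finset ι) (c a : V)
    (hsep : ∀ i ∈ E₁, ∀ j ∈ E₂, ∀ u, u ∈ ends i → u ∈ ends j → u = c) (hω₁ : ω₁ ⊆ E₁) (hω₂ : ω₂ ⊆ E₂)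
    (ha : ∀ j ∈ E₂, a ∉ ends j) :
    c ∈ openCluster (ends '' (↑(ω₁ ∪ ω₂) : Set ι)) a ↔ c ∈ openCluster (ends '' (↑ω₁ : Set ι)) a := by
  rw [openCluster_cut_side ends E₁ E₂ ω₁ ω₂ c a hsep hω₁ hω₂ ha]
  constructor
  · rintro (h | ⟨h, _⟩) <;> exact h
  · intro h; exact Or.inl h

end Coefficientwise

end Summit.CriticalPhenomena.PercolationContinuityZ3.Theorems
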